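import Literature.AlgebraicGeometry.Resolution.HasSNCWithOffCentre
import HarnessLib

/-!
# Crux `PatchingRelPerfect` (stmt-ResolutionOfSingularities-16161), chain W5.2 — rung R4ˢ-general, END-SNC support:
# simple normal crossings AT A POINT (`SNCWithAt`), and chart data over the centre from the pointwise hypothesis

[OURS · L1 W5.2 · rung tool] Replaces the role of NO printed item; NOT a statement of the manuscript under review;
fact-free, any dimension. The END phase of the mixed engine (res-L1-w52-plan-1 F5 DESIGN MEMO dbeef0c69494cc5e, T5-H
`EndSNCTwo`) needs simple normal crossings of the X-side family `[𝓐'] ++ 𝒢' ++ [𝓘_{E'}]` only NEAR THE COSUPPORT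
of the residual `K'` — the host `𝓐'` is singular far from `E'` — so the global predicate `HasSNCWith`
(`Literature/…/MarkedIdeals.lean`) and its transport `HasSNCWith.hasSNC_transform` (`…/BlowupSNC.lean`, Kollár Def. 3.25)
must be localised AT A POINT. This file does exactly that, re-using the chart machinery of `BlowupSNC.lean`
(`ChartData`, whose constructor `exists_chartData` reads the global hypothesis only at the image point):

* `SNCWithAt E C x` — the body of `HasSNCWith E C` at the point `x` (regular local ring, a regular system of
  parameters in which every member of `E` through `x` is a coordinate hyperplane, distinct members getting
  distinct coordinates, and `C_x` generated by a subset of the coordinates if `x ∈ V(C)`), in the «labels» form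
  `∃ d, …` of `hasSNC_of_labels`; `hasSNCWith_iff_sncWithAt : HasSNCWith E C ↔ ∀ x, SNCWithAt E C x`;
  bookkeeping `SNCWithAt.of_not_mem_support` (change of centre off its support), `SNCWithAt.top`,
  `SNCWithAt.anti` (sub-families), `SNCWithAt.congr_mem` (only membership matters).
* `exists_chartData_of_sncWithAt` — chart data at a point `x'` of a blow-up over the centre from `SNCWithAt E C (π x')`
  ALONE (verbatim `exists_chartData`).
* The TRANSPORT theorems (over the centre / off the centre with a second centre / corollaries) are in the
  companion file `…DepthSNCPointwiseTransport.lean` (400-line rule).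

USE (W5.2): res-D-pv-052's E′-locus half of END-SNC produces `SNCWithAt` at the points of `i(E)` by the retraction
lift; this file carries it (a) to every point of the blow-up over a deficient centre — the new carrier with its
POCKETS — and (b) unchanged through all later blow-ups at points off their centres (res-D-pv-009's off-`E′` half).

## References
* J. Kollár, *Lectures on Resolution of Singularities* (2007), Def. 3.24, Def. 3.25. [Kollar2007]
* E. Bierstone, D. Grigoriev, P. Milman, J. Włodarczyk, arXiv:1206.3090, Def. 3.1.1, Def. 3.1.3 (2), (4).
  [BierstoneGrigorievMilmanWlodarczyk2011]
* The Stacks Project, Tags 0804, 02OS. [StacksProject]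
-/

-- `Summit.<Summit>.<Sub>.Theorems` with `Sub = Summit` (single-conjunct summit, D-0017)
set_option linter.dupNamespace false

noncomputable section

open CategoryTheory CategoryTheory.Limits AlgebraicGeometry TopologicalSpace IsLocalRing
open Literature.AlgebraicGeometry.Resolution

namespace Summit.ResolutionOfSingularities.ResolutionOfSingularities.Theorems

universe u

namespace DepthSNC

/-! ## §1 Simple normal crossings at a point -/

/-- [OURS · L1 W5.2] **Simple normal crossings of `E` with the centre `C` AT THE POINT `x`** — the body of the tree's
`HasSNCWith E C` at `x`, in labels form: `𝒪_{X,x}` is regular and has a regular system of parameters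
`v₁, …, v_d` (`d` the embedding dimension) such that every member of `E` through `x` has stalk `(v_i)`, distinct
members getting distinct indices, and, if `x ∈ V(C)`, `C_x` is generated by a subset of the `v_i`.
[cite: BierstoneGrigorievMilmanWlodarczyk2011, Def. 3.1.1 and Def. 3.1.3 (2)] [cite: Kollar2007, Def. 3.24] -/
def SNCWithAt {X : Scheme.{u}} (E : List X.IdealSheafData) (C : X.IdealSheafData) (x : X) : Prop :=
  IsRegularLocalRing (X.presheaf.stalk x) ∧
    ∃ (d : ℕ) (v : Fin d → X.presheaf.stalk x), (maximalIdeal (X.presheaf.stalk x)).spanFinrank = d ∧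
      Ideal.span (Set.range v) = maximalIdeal (X.presheaf.stalk x) ∧
      (∃ ι : {D : X.IdealSheafData // D ∈ E ∧ x ∈ D.support} → Fin d,
        Function.Injective ι ∧ ∀ D, stalkIdeal D.1 x = Ideal.span {v (ι D)}) ∧
      (x ∈ C.support → ∃ S : Set (Fin d), stalkIdeal C x = Ideal.span (v '' S))

variable {X : Scheme.{u}}

/-- `HasSNCWith E C` is `SNCWithAt E C x` at every point. [folklore] -/
theorem hasSNCWith_iff_sncWithAt (E : List X.IdealSheafData) (C : X.IdealSheafData) :
    HasSNCWith E C ↔ ∀ x, SNCWithAt E C x := by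
  refine forall_congr' fun x => and_congr Iff.rfl ⟨?_, ?_⟩
  · rintro ⟨u, hu, hι, hC⟩
    exact ⟨_, u, rfl, hu, hι, hC⟩
  · rintro ⟨d, v, hd, hv, hι, hC⟩
    subst hd
    exact ⟨v, hv, hι, hC⟩

/-- The global predicate gives the pointwise one. [folklore] -/
theorem _root_.Literature.AlgebraicGeometry.Resolution.HasSNCWith.sncWithAt {E : List X.IdealSheafData}
    {C : X.IdealSheafData} (h : HasSNCWith E C) (x : X) : SNCWithAt E C x :=
  (hasSNCWith_iff_sncWithAt E C).mp h x

/-- The pointwise predicate everywhere gives the global one. [folklore] -/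
theorem hasSNCWith_of_forall_sncWithAt {E : List X.IdealSheafData} {C : X.IdealSheafData}
    (h : ∀ x, SNCWithAt E C x) : HasSNCWith E C :=
  (hasSNCWith_iff_sncWithAt E C).mpr h

namespace SNCWithAt

variable {E : List X.IdealSheafData} {C : X.IdealSheafData} {x : X}

/-- The regular-stalk half. [folklore] -/
theorem isRegularLocalRing (h : SNCWithAt E C x) : IsRegularLocalRing (X.presheaf.stalk x) := h.1

/-- Forgetting the centre. [folklore] -/
theorem top (h : SNCWithAt E C x) : SNCWithAt E ⊤ x := by
  obtain ⟨hreg, d, v, hd, hv, hι, -⟩ := h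
  refine ⟨hreg, d, v, hd, hv, hι, fun hx => ?_⟩
  rw [Scheme.IdealSheafData.support_top] at hx
  exact absurd hx id

/-- **Change of centre off its support**: at a point not on `V(C')` the centre clause is vacuous. [folklore] -/
theorem of_not_mem_support (h : SNCWithAt E C x) {C' : X.IdealSheafData} (hx : x ∉ C'.support) :
    SNCWithAt E C' x := by
  obtain ⟨hreg, d, v, hd, hv, hι, -⟩ := h
  exact ⟨hreg, d, v, hd, hv, hι, fun hx' => absurd hx' hx⟩

/-- **Sub-families**: if every member of `E'` through `x` is a member of `E`, then `SNCWithAt E C x` gives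
`SNCWithAt E' C x`. [folklore] -/
theorem anti (h : SNCWithAt E C x) {E' : List X.IdealSheafData}
    (hE' : ∀ D ∈ E', x ∈ D.support → D ∈ E) : SNCWithAt E' C x := by
  obtain ⟨hreg, d, v, hd, hv, ⟨ι, hι, hιD⟩, hC⟩ := h
  refine ⟨hreg, d, v, hd, hv, ⟨fun D => ι ⟨D.1, hE' D.1 D.2.1 D.2.2, D.2.2⟩, ?_, ?_⟩, hC⟩
  · intro D₁ D₂ h12
    have h' := congrArg Subtype.val (hι h12)
    exact Subtype.ext h'
  · intro D
    exact hιD ⟨D.1, hE' D.1 D.2.1 D.2.2, D.2.2⟩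

/-- **Only membership matters**: lists with the same members through `x` are interchangeable. [folklore] -/
theorem congr_mem (h : SNCWithAt E C x) {E' : List X.IdealSheafData}
    (hE' : ∀ D, x ∈ D.support → (D ∈ E' ↔ D ∈ E)) : SNCWithAt E' C x :=
  h.anti fun D hD hx => (hE' D hx).mp hD

/-- Appending members that miss `x` changes nothing. [folklore] -/
theorem append_of_not_mem_support (h : SNCWithAt E C x) {E' : List X.IdealSheafData}
    (hE' : ∀ D ∈ E', x ∉ D.support) : SNCWithAt (E ++ E') C x := by
  refine h.anti fun D hD hx => ?_
  rcases List.mem_append.mp hD with h1 | h1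
  · exact h1
  · exact absurd hx (hE' D h1)

end SNCWithAt

/-! ## §2 Chart data at a point over the centre, from the pointwise hypothesis -/

/-- **Chart data at a point `x'` of the blow-up over the centre, from `SNCWithAt E C (π x')` alone** — verbatim the
tree's `exists_chartData` (which reads its global hypothesis `HasSNCWith E C` only at `π x'`): an affine open on
which the centre is generated by a quasi-regular sequence, part of a regular system of parameters at `π x'` adapted
to the members of `E` through `π x'`, and the chart of the blow-up at `x'`. [cite: StacksProject, Tag 0804] -/
theorem exists_chartData_of_sncWithAt [IsLocallyNoetherian X] {X' : Scheme.{u}} {π : X' ⟶ X}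
    {C : X.IdealSheafData} (hπ : IsBlowup π C) {E : List X.IdealSheafData} (x' : X')
    (hE : SNCWithAt E C (π x')) (hxC : π x' ∈ C.support) :
    ∃ (D : ChartData π C x')
      (τ : {K : X.IdealSheafData // K ∈ E ∧ π x' ∈ K.support} → Fin D.r ⊕ Fin D.a),
      Function.Injective τ ∧
      ∀ K, stalkIdeal K.1 (π x') =
        Ideal.span {Sum.elim (fun j => (X.presheaf.germ D.U (π x') D.hxU).hom (D.x j))
          (fun m => (X.presheaf.germ D.U (π x') D.hxU).hom (D.w m)) (τ K)} := by
  classical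
  obtain ⟨hreg, d₀, u₀, hd₀, hu₀, ⟨ι₀, hι₀inj, hι₀⟩, hC₀⟩ := hE
  obtain ⟨S₀, hS₀⟩ := hC₀ hxC
  -- an affine open and sections with associated germs
  obtain ⟨U₁, hU₁, hxU₁, -⟩ :=
    exists_isAffineOpen_mem_and_subset (X := X) (x := π x') (U := ⊤) (Opens.mem_top _)
  obtain ⟨sec, hsec⟩ := exists_sections_associated (X := X) ⟨U₁, hU₁⟩ hxU₁ u₀
  set u₁ : Fin d₀ → X.presheaf.stalk (π x') :=
    fun t => (X.presheaf.germ U₁ (π x') hxU₁).hom (sec t) with hu₁def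
  have hu₁span : Ideal.span (Set.range u₁) = maximalIdeal _ :=
    (Ideal.span_range_eq_of_associated hsec).symm.trans hu₀
  -- enumerations of `S₀` and of its complement
  set Sfin : Finset (Fin d₀) := S₀.toFinite.toFinset with hSfindef
  have hSfin : ∀ t, t ∈ Sfin ↔ t ∈ S₀ := fun t => Set.Finite.mem_toFinset _
  set enumS : Fin Sfin.card → Fin d₀ := fun l => (Sfin.equivFin.symm l).1 with henumS
  set enumW : Fin Sfinᶜ.card → Fin d₀ := fun m => (Sfinᶜ.equivFin.symm m).1 with henumW
  have henumS_mem : ∀ l, enumS l ∈ S₀ := fun l => (hSfin _).mp (Sfin.equivFin.symm l).2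
  have henumW_nmem : ∀ m, enumW m ∉ S₀ := fun m =>
    (hSfin _).not.mp (Finset.mem_compl.mp (Sfinᶜ.equivFin.symm m).2)
  have henumS_inj : Function.Injective enumS := fun l l' h =>
    Sfin.equivFin.symm.injective (Subtype.ext h)
  have henumW_inj : Function.Injective enumW := fun m m' h =>
    Sfinᶜ.equivFin.symm.injective (Subtype.ext h)
  -- the stalk of `C` is generated by the `u₁ ∘ enumS`
  have hrangeS : Set.range (u₁ ∘ enumS) = u₁ '' S₀ := by
    ext y
    constructor
    · rintro ⟨l, rfl⟩
      exact ⟨enumS l, henumS_mem l, rfl⟩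
    · rintro ⟨t, ht, rfl⟩
      exact ⟨Sfin.equivFin ⟨t, (hSfin t).mpr ht⟩, by simp [henumS]⟩
  have hCst : stalkIdeal C (π x') =
      Ideal.span (Set.range fun l => (X.presheaf.germ U₁ (π x') hxU₁).hom (sec (enumS l))) := by
    rw [hS₀, span_image_eq_of_associated hsec S₀, ← hrangeS]
    rfl
  have hrsop : IsRsopPart fun l => (X.presheaf.germ U₁ (π x') hxU₁).hom (sec (enumS l)) :=
    isRsopPart_comp_of_rsop hd₀ u₁ hu₁span enumS henumS_inj
  obtain ⟨g, hxg, hspanC, hqr⟩ :=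
    exists_basicOpen_span_eq_isQuasiRegular ⟨U₁, hU₁⟩ hxU₁ C (fun l => sec (enumS l)) hCst hrsop
  -- the affine open `U = D(g)` and the sections restricted to it
  have hxU : π x' ∈ ((X.affineBasicOpen (U := ⟨U₁, hU₁⟩) g : X.affineOpens) : X.Opens) := hxg
  have hgerm : ∀ s : Γ(X, U₁), (X.presheaf.germ (X.affineBasicOpen (U := ⟨U₁, hU₁⟩) g) (π x') hxU).hom
      ((X.presheaf.map (homOfLE (X.basicOpen_le g)).op).hom s) =
      (X.presheaf.germ U₁ (π x') hxU₁).hom s := fun s =>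
    TopCat.Presheaf.germ_res_apply X.presheaf _ _ _ s
  obtain ⟨i, V, hVU, e, hx'V, he⟩ := hπ.exists_generator_chart _ hxU _ hspanC
  -- the dimension count and the regular system of parameters
  have hd : (maximalIdeal (X.presheaf.stalk (π x'))).spanFinrank = Sfin.card + Sfinᶜ.card := by
    rw [Finset.card_add_card_compl, Fintype.card_fin, hd₀]
  have hu : Ideal.span (Set.range (Fin.append
      (fun j => (X.presheaf.germ (X.affineBasicOpen (U := ⟨U₁, hU₁⟩) g) (π x') hxU).hom
        ((X.presheaf.map (homOfLE (X.basicOpen_le g)).op).hom (sec (enumS j))))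
      (fun m => (X.presheaf.germ (X.affineBasicOpen (U := ⟨U₁, hU₁⟩) g) (π x') hxU).hom
        ((X.presheaf.map (homOfLE (X.basicOpen_le g)).op).hom (sec (enumW m)))))) =
      maximalIdeal (X.presheaf.stalk (π x')) := by
    refine Eq.trans ?_ hu₁span
    congr 1
    ext y
    constructor
    · rintro ⟨k, rfl⟩
      induction k using Fin.addCases with
      | left j => exact ⟨enumS j, by rw [Fin.append_left, hgerm]⟩
      | right m => exact ⟨enumW m, by rw [Fin.append_right, hgerm]⟩
    · rintro ⟨t, rfl⟩
      by_cases ht : t ∈ S₀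
      · refine ⟨Fin.castAdd _ (Sfin.equivFin ⟨t, (hSfin t).mpr ht⟩), ?_⟩
        rw [Fin.append_left, hgerm]
        simp [hu₁def, henumS]
      · refine ⟨Fin.natAdd _ (Sfinᶜ.equivFin ⟨t, Finset.mem_compl.mpr ((hSfin t).not.mpr ht)⟩), ?_⟩
        rw [Fin.append_right, hgerm]
        simp [hu₁def, henumW]
  let D : ChartData π C x' :=
    { U := X.affineBasicOpen (U := ⟨U₁, hU₁⟩) g
      hxU := hxU
      r := Sfin.card
      a := Sfinᶜ.card
      x := fun l => (X.presheaf.map (homOfLE (X.basicOpen_le g)).op).hom (sec (enumS l))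
      w := fun m => (X.presheaf.map (homOfLE (X.basicOpen_le g)).op).hom (sec (enumW m))
      hqr := hqr
      hspanC := hspanC
      i := i
      V := V
      hVU := hVU
      hx'V := hx'V
      e := e
      he := he
      hreg := hreg
      hd := hd
      hu := hu }
  -- the labelling of the old divisors through `π x'`
  let τ : {K : X.IdealSheafData // K ∈ E ∧ π x' ∈ K.support} → Fin D.r ⊕ Fin D.a := fun K =>
    if h : ι₀ K ∈ S₀ then Sum.inl (Sfin.equivFin ⟨ι₀ K, (hSfin _).mpr h⟩)
    else Sum.inr (Sfinᶜ.equivFin ⟨ι₀ K, Finset.mem_compl.mpr ((hSfin _).not.mpr h)⟩)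
  refine ⟨D, τ, ?_, ?_⟩
  · intro K K' hKK'
    apply hι₀inj
    by_cases h : ι₀ K ∈ S₀ <;> by_cases h' : ι₀ K' ∈ S₀ <;>
      simp only [τ, dif_pos, dif_neg, h, h', not_false_eq_true, Sum.inl.injEq, Sum.inr.injEq,
        reduceCtorEq] at hKK'
    · exact congrArg Subtype.val (Sfin.equivFin.injective hKK')
    · exact congrArg Subtype.val (Sfinᶜ.equivFin.injective hKK')
  · intro K
    have hK : stalkIdeal K.1 (π x') = Ideal.span {u₁ (ι₀ K)} := by
      have h1 := span_image_eq_of_associated hsec {ι₀ K}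
      rw [Set.image_singleton, Set.image_singleton] at h1
      rw [hι₀ K, h1]
    rw [hK]
    by_cases h : ι₀ K ∈ S₀
    · simp only [τ, dif_pos h, Sum.elim_inl]
      congr 2
      change u₁ (ι₀ K) = (X.presheaf.germ (X.affineBasicOpen (U := ⟨U₁, hU₁⟩) g) (π x') hxU).hom
        ((X.presheaf.map (homOfLE (X.basicOpen_le g)).op).hom (sec (enumS _)))
      rw [hgerm]
      simp [hu₁def, henumS]
    · simp only [τ, dif_neg h, Sum.elim_inr]
      congr 2
      change u₁ (ι₀ K) = (X.presheaf.germ (X.affineBasicOpen (U := ⟨U₁, hU₁⟩) g) (π x') hxU).hom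
        ((X.presheaf.map (homOfLE (X.basicOpen_le g)).op).hom (sec (enumW _)))
      rw [hgerm]
      simp [hu₁def, henumW]

end DepthSNC

end Summit.ResolutionOfSingularities.ResolutionOfSingularities.Theorems

end
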